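import Literature.Computability.AlgebraicComplexity.OrbitClosureEuclidean
import Literature.Computability.AlgebraicComplexity.MS2001ClassVarieties
import Literature.Computability.AlgebraicComplexity.DeterminantalComplexityProofs
import Literature.Computability.AlgebraicComplexity.GCT
import Literature.Computability.AlgebraicComplexity.QuasiPolynomialFormulasProofs
import Literature.Computability.AlgebraicComplexity.DetInVP
import HarnessLib

/-!
# GCT I Prop. 4.4: if Conj. 4.3 fails, `perm` is approximated infinitesimally closely by
# determinants of affine matrices of polynomial size — PROOF

Topic `Computability/AlgebraicComplexity`. Cell `val-lit`, row MS2001-A (K. Mulmuley, M. Sohoni,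
*Geometric complexity theory I*, SIAM J. Comput. 31 (2001) 496–526), §4, typed from the AUTHORS'
VERSION (AV; text of record `HOME/bip/texts/MS2001-authorversion/`, locators «AV p.N, all.txt
Lnnnn»). The row «Prop 4.4» of `HOME/bip/CHECK-t01.md` was CITED "in substance" (Zariski =
Euclidean closure, `orbitClosure_eq_euclidean_closure_complex_holds`; interior points have
`dc ≤ m`, `IsInteriorLimitPoint.hasDetRepr`) with the «approximating formula» phrasing SKIPPED.
This file PROVES the proposition in the form its printed proof establishes (approximation of the
coefficients of `perm(X)` by those of `det(W)`, `W` an `m × m` matrix of affine linear forms in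
`X`), and (§4) the last clause of the print ("such a function `det(W)` has a formula of size
`m^{O(log m)}` [2]", Berkowitz) quantitatively, from the tree's polynomial-size circuits for
`det_m` (`complexity_detPoly_le`) and the BCS (21.35)/(21.36) formula-size bookkeeping
(`formulaComplexity_le_two_pow`). Theorems and one bodied definition (the substitution of the
proof): no named facts, no instances, no `sorry`.

## The source (AV p.14, all.txt L857–898)

> **Proposition 4.4** Suppose `F` is the field of complex numbers. If Conjecture 4.3 were false
> then `perm(X)` can be approximated infinitesimally closely by a formula of quasi-polynomial
> `n^{O(log n)}` size (in the sense that the coefficients of the polynomial computed by this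
> formula would be infinitesimally close to those of the permanent).
> *Proof:* If the conjecture were false, `perm^φ(Y)` lies in the closure of the `SL_{m²}`-orbit
> of `det(Y)` in `P(V)`, with `m = poly(n)`. This means, as a point in `V`, it lies in the
> closure of the `GL_{m²}`-orbit of `det(Y)`. So it can be approximately infinitesimally closely
> by a function of the form `det(σ⁻¹Y)`, for some `σ ∈ GL_{m²}`. Let us ignore the terms in this
> approximation that involve variables other than `y` or entries of `X = φ(X)`, which cannot
> occur in `perm^φ(Y)`; i.e., think of setting these variables of `Y` to zero. What remains is
> still an approximation to `perm^φ(Y)`. Setting `y` to one, we get an infinitesimally close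
> approximation to `perm(X)` by a function of the form `det(W)`, where `W` is an
> `m² × m²`-matrix [sic; `m × m`] whose each entry is a (possibly nonhomogeneous) linear
> combination of the entries of `X`. But such a function `det(W)` has a formula of size
> `m^{O(log m)} = n^{O(log n)}` [2]. Q.E.D.

## Contents

* `MS2001Prop44.blockSubst n m` — the substitution of the proof: the entries of the `n × n`
  block `X` of the `m × m` variable matrix `Y` are kept, the padding variable `y = Y₀₀` is set
  to `1`, every other variable of `Y` to `0` (`aeval_blockSubst_paddedPerPoly`:
  it sends `perm^φ(Y) = y^{m-n} perm(X)` to `perm(X)`).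
* `MS2001_prop_4_4_hasDetRepr` — **Prop. 4.4, the proof's statement**: over `ℂ`, if
  `perm^φ(Y) ∈ Δ[det_m(Y)]` (`n ≤ m`), then for every `ε > 0` there is a polynomial `q(X)` with an
  affine determinantal representation of size `m` (`HasDetRepr q m`: `q = det(W)`, `W` an `m × m`
  matrix of affine linear forms in `X`) all of whose coefficients are within `ε` of those of
  `perm(X)`.
* `MS2001_prop_4_4` — **Prop. 4.4 as printed, from the negation of Conj. 4.3** (the tree's
  `MulmuleySohoniConjecture`, GCT I Conj. 4.3 with the polynomial window `m ≤ n^c`): if the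
  conjecture is false then for some exponent `c` and infinitely many `n` the permanent `perm_n`
  is approximated infinitesimally closely, coefficientwise, by determinants `det(W)` of `m × m`
  affine matrices with `n ≤ m ≤ n^c`.
* §4 the formula clause "[2]": `complexity_le_of_hasDetRepr` (`det(W)`, `W` an `m × m` affine
  matrix in `#σ` variables, has a circuit of size `≤ 8(m+1)^7 + m²(2#σ+2)`),
  `formulaComplexity_le_of_hasDetRepr` (… and a fan-in-two FORMULA of size
  `≤ 2^{18(7 log₂(m+1)+11)²} = m^{O(log m)}` when `#σ ≤ (m+1)²`), and **`MS2001_prop_4_4_formula`**: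
  Prop. 4.4 verbatim — ¬Conj. 4.3 ⇒ for some `c, c'` and infinitely many `n`, `perm_n` is
  approximated infinitesimally closely by polynomials having formulas of size
  `≤ 2^{c'(log₂ n + 1)²} = n^{O(log n)}` (and `dc ≤ m ≤ n^c`).
* §5 `MS2001_sec_4_2_approx_of_mem_orbitClosure_detPoly` — the §4.2 remark "though `h(Y)` is an
  exterior limit point, it can be approximated infinitesimally closely by a formula of
  quasi-polynomial size (Proposition 4.4)" (AV p.18 L1296–1298): EVERY point of `Δ[det_m]` over
  `ℂ` is coefficientwise `ε`-close to an orbit point `det(σ⁻¹Y)`, of `dc ≤ m` and formula size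
  `m^{O(log m)}`.

## Rendering (disclosed)

* `perm^φ(Y)` is the tree's `paddedPerPoly ℂ n m = Y₀₀^{m-n} · perm(X)`, `X` the bottom-right
  `n × n` block of `Y` (indices `BlockIdx n m`), padding variable `Y₀₀ ∉ X` for `n < m`; `Δ[det_m]`
  is the tree's Zariski `orbitClosure (detPoly (Fin m) ℂ)` (closure of `GL_{m²} · det_m` in `V`),
  which is how the tree's `MulmuleySohoniConjecture` reads Conj. 4.3; the passage from the
  projective `SL`-orbit closure to the affine `GL`-orbit closure in the first sentence of the
  proof is therefore already built into the hypothesis.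
* "perm(X)" of the conclusion is `perPoly (BlockIdx n m) ℂ`, the permanent of the block's own
  `n × n` variable matrix (`Fintype.card (BlockIdx n m) = n`, `card_blockIdx`).
* "infinitesimally close … coefficients": for every `ε > 0`, every coefficient of `q - perm(X)`
  has absolute value `< ε` (all but finitely many vanish).
* PROOF as printed: Zariski closure = Euclidean closure of `GL · det` over `ℂ`
  (`orbitClosure_eq_euclidean_closure_complex_holds`, the §4.1 fact the print uses silently:
  "This means, as a point in `V`, it lies in the closure"), a point `det(σ⁻¹Y)` of the orbit
  coefficientwise close to `perm^φ`, then the substitution `blockSubst` (a continuous linear map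
  on coefficient vectors of degree-`m` forms; its matrix has entries of absolute value `≤ 1`),
  and `det(σ⁻¹Y) ↦ det(W)` with `W` affine in `X` (`IsInteriorLimitPoint.hasDetRepr` and
  substitution of affine forms, Bürgisser 2000 §2.5).

Honest framing: literature typing; Conj. 4.3 (`MulmuleySohoniConjecture`) is OPEN and used only
as a negated hypothesis; nothing here bears on any separation (`VP ≠ VNP` is NOT proved).

## References

* [MulmuleySohoniSIAM2001] K. Mulmuley, M. Sohoni, *Geometric complexity theory I*, SIAM J.
  Comput. 31 (2001) 496–526, Prop. 4.4 (AV p.14, all.txt L857–898); Conj. 4.3 (AV p.13, L838).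
* [Burgisser2000] P. Bürgisser, *Completeness and Reduction in Algebraic Complexity Theory*,
  Springer 2000, §2.5 (affine determinantal expressions under substitution), Rem. 2.7
  (`complexity_aeval_le`).
* [BurgisserClausenShokrollahi1997] P. Bürgisser, M. Clausen, M. A. Shokrollahi, *Algebraic
  Complexity Theory*, Springer 1997, Thms. (21.35)/(21.36) pp. 563–568 (formula size from circuit
  size and degree; the tree's `formulaComplexity_le_two_pow`).
-/

noncomputable section

open MvPolynomial

namespace Literature.Computability.AlgebraicComplexity

/-! ## §1. The substitution `y ↦ 1`, `X ↦ X`, other variables `↦ 0` -/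

section Subst

variable (n m : ℕ) [NeZero m]

/-- The substitution of the proof of Prop. 4.4 (AV p.14 L883–886: "think of setting these
variables of `Y` to zero … Setting `y` to one"): a variable of the `m × m` matrix `Y` lying in
the bottom-right `n × n` block `X` is kept (as the corresponding variable of `X`), the padding
variable `Y₀₀` goes to `1`, every other variable to `0`. (For `n ≥ m` the block is all of `Y`
and nothing is set to a constant.) [cite: MulmuleySohoniSIAM2001, Prop. 4.4 proof (AV p.14, all.txt L883–886)] -/
def MS2001Prop44.blockSubst (v : Fin m × Fin m) :
    MvPolynomial (BlockIdx n m × BlockIdx n m) ℂ :=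
  if h : m - n ≤ (v.1 : ℕ) ∧ m - n ≤ (v.2 : ℕ) then X (⟨v.1, h.1⟩, ⟨v.2, h.2⟩)
  else if v = (0, 0) then 1 else 0

open MS2001Prop44

/-- On a block variable the substitution is that variable. [cite: MulmuleySohoniSIAM2001, Prop. 4.4 proof (AV p.14, all.txt L883–886)] -/
theorem MS2001Prop44.blockSubst_block (ij : BlockIdx n m × BlockIdx n m) :
    blockSubst n m ((ij.1 : Fin m), (ij.2 : Fin m)) = X ij := by
  unfold blockSubst
  rw [dif_pos ⟨ij.1.2, ij.2.2⟩]

/-- The padding factor `Y₀₀^{m-n}` goes to `1`. [cite: MulmuleySohoniSIAM2001, Prop. 4.4 proof (AV p.14, all.txt L886)] -/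
theorem MS2001Prop44.blockSubst_zero_pow : blockSubst n m (0, 0) ^ (m - n) = 1 := by
  rcases Nat.eq_zero_or_pos (m - n) with h0 | hpos
  · rw [h0, pow_zero]
  · have h : ¬ (m - n ≤ ((0 : Fin m) : ℕ) ∧ m - n ≤ ((0 : Fin m) : ℕ)) := by
      rw [Fin.val_zero, and_self]
      omega
    unfold blockSubst
    rw [dif_neg h, if_pos rfl, one_pow]

/-- Every value of the substitution has total degree `≤ 1` (a variable, `1` or `0`).
[cite: MulmuleySohoniSIAM2001, Prop. 4.4 proof (AV p.14, all.txt L886–890)] -/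
theorem MS2001Prop44.totalDegree_blockSubst_le (v : Fin m × Fin m) :
    (blockSubst n m v).totalDegree ≤ 1 := by
  unfold blockSubst
  split_ifs
  · exact (totalDegree_X _).le
  · rw [totalDegree_one]; exact Nat.zero_le _
  · rw [totalDegree_zero]; exact Nat.zero_le _

/-- Every power of a value of the substitution is a monomial with coefficient `0` or `1`.
[folklore] -/
private theorem MS2001Prop44.blockSubst_pow_eq_monomial (v : Fin m × Fin m) (j : ℕ) :
    ∃ s : BlockIdx n m × BlockIdx n m →₀ ℕ, ∃ c : ℂ, (c = 0 ∨ c = 1) ∧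
      blockSubst n m v ^ j = monomial s c := by
  unfold blockSubst
  split_ifs
  · exact ⟨Finsupp.single _ j, 1, Or.inr rfl, by rw [X_pow_eq_monomial]⟩
  · exact ⟨0, 1, Or.inr rfl, by rw [one_pow]; rfl⟩
  · rcases Nat.eq_zero_or_pos j with rfl | hj
    · exact ⟨0, 1, Or.inr rfl, by rw [pow_zero]; rfl⟩
    · exact ⟨0, 0, Or.inl rfl, by rw [zero_pow hj.ne', monomial_zero', C_0]⟩

/-- The substitution sends each monomial of `Y` to a monomial of `X` with coefficient `0` or `1`.
[folklore] -/
private theorem MS2001Prop44.aeval_blockSubst_monomial_eq (d : Fin m × Fin m →₀ ℕ) :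
    ∃ s : BlockIdx n m × BlockIdx n m →₀ ℕ, ∃ c : ℂ, (c = 0 ∨ c = 1) ∧
      aeval (blockSubst n m) (monomial d (1 : ℂ)) = monomial s c := by
  classical
  rw [aeval_monomial, map_one, one_mul, Finsupp.prod]
  induction d.support using Finset.induction_on with
  | empty => exact ⟨0, 1, Or.inr rfl, by rw [Finset.prod_empty]; rfl⟩
  | insert v s hv ih =>
    obtain ⟨s₁, c₁, hc₁, h₁⟩ := ih
    obtain ⟨s₂, c₂, hc₂, h₂⟩ := blockSubst_pow_eq_monomial n m v (d v)
    refine ⟨s₂ + s₁, c₂ * c₁, ?_, by rw [Finset.prod_insert hv, h₁, h₂, monomial_mul]⟩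
    rcases hc₁ with rfl | rfl
    · exact Or.inl (mul_zero _)
    · rcases hc₂ with rfl | rfl
      · exact Or.inl (zero_mul _)
      · exact Or.inr (mul_one _)

/-- The matrix entries of the substitution on coefficient vectors have absolute value `≤ 1`.
[folklore] -/
private theorem MS2001Prop44.norm_coeff_aeval_blockSubst_monomial_le (d : Fin m × Fin m →₀ ℕ)
    (e : BlockIdx n m × BlockIdx n m →₀ ℕ) :
    ‖coeff e (aeval (blockSubst n m) (monomial d (1 : ℂ)))‖ ≤ 1 := by
  classical
  obtain ⟨s, c, hc, h⟩ := aeval_blockSubst_monomial_eq n m d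
  rw [h, coeff_monomial]
  split_ifs
  · rcases hc with rfl | rfl <;> simp
  · simp

/-- **The substitution sends `perm^φ(Y) = y^{m-n} perm(X)` to `perm(X)`** (AV p.14 L884–886:
"What remains is still an approximation to `perm^φ(Y)`. Setting `y` to one, we get …
`perm(X)`"). [cite: MulmuleySohoniSIAM2001, Prop. 4.4 proof (AV p.14, all.txt L884–886)] -/
theorem MS2001Prop44.aeval_blockSubst_paddedPerPoly :
    aeval (blockSubst n m) (paddedPerPoly ℂ n m) = perPoly (BlockIdx n m) ℂ := by
  rw [paddedPerPoly, map_mul, map_pow, aeval_X, blockSubst_zero_pow, one_mul, aeval_rename]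
  have h : (blockSubst n m ∘ fun ij : BlockIdx n m × BlockIdx n m =>
      ((ij.1 : Fin m), (ij.2 : Fin m))) = X := by
    funext ij
    exact blockSubst_block n m ij
  rw [h, aeval_X_left, AlgHom.coe_id, id]

end Subst

/-! ## §2. Coefficient bookkeeping: the substitution is a bounded linear map on degree-`m` forms -/

section Coeff

open MS2001Prop44

variable {n m : ℕ} [NeZero m]

/-- For a form `g` of degree `m` in `Y`, each coefficient of its substitution is the linear
combination `∑_{|d| = m} coeff_d(g) · coeff_e(Y^d ∘ subst)` of the coefficients of `g`. [folklore] -/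
private theorem MS2001Prop44.coeff_aeval_eq_sum [Fintype {d : Fin m × Fin m →₀ ℕ // d.degree = m}]
    {g : MvPolynomial (Fin m × Fin m) ℂ} (hg : g.IsHomogeneous m)
    (e : BlockIdx n m × BlockIdx n m →₀ ℕ) :
    coeff e (aeval (blockSubst n m) g) =
      ∑ d : {d : Fin m × Fin m →₀ ℕ // d.degree = m},
        coeff d.1 g * coeff e (aeval (blockSubst n m) (monomial d.1 (1 : ℂ))) := by
  classical
  have hmem : ∀ d : Fin m × Fin m →₀ ℕ,
      d ∈ (Finset.univ : Finset (Fin m × Fin m)).finsuppAntidiag m ↔ d.degree = m := fun d => by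
    simp [Finset.mem_finsuppAntidiag, Finsupp.degree_eq_sum]
  have hsupp : g.support ⊆ (Finset.univ : Finset (Fin m × Fin m)).finsuppAntidiag m := by
    intro d hd
    refine (hmem d).2 ?_
    rw [Finsupp.degree_eq_weight_one]
    exact hg (mem_support_iff.1 hd)
  calc coeff e (aeval (blockSubst n m) g)
      = coeff e (aeval (blockSubst n m) (∑ d ∈ g.support, monomial d (coeff d g))) := by
        rw [← as_sum]
    _ = ∑ d ∈ g.support, coeff d g * coeff e (aeval (blockSubst n m) (monomial d (1 : ℂ))) := by
        rw [map_sum, coeff_sum]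
        refine Finset.sum_congr rfl fun d _ => ?_
        rw [show monomial d (coeff d g) = coeff d g • monomial d (1 : ℂ) by
          rw [smul_monomial, smul_eq_mul, mul_one], map_smul, coeff_smul, smul_eq_mul]
    _ = ∑ d ∈ (Finset.univ : Finset (Fin m × Fin m)).finsuppAntidiag m,
          coeff d g * coeff e (aeval (blockSubst n m) (monomial d (1 : ℂ))) :=
        Finset.sum_subset hsupp fun d _ hd => by rw [notMem_support_iff.1 hd, zero_mul]
    _ = _ := Finset.sum_subtype _ hmem _

/-- Substituting polynomials of total degree `≤ 1` keeps affine determinantal expressions of each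
size (Bürgisser 2000 §2.5; twin of the tree's `hasDetRepr_aeval_linear`). [cite: Burgisser2000, §2.5] -/
private theorem MS2001Prop44.hasDetRepr_aeval {σ τ : Type*} {f : MvPolynomial σ ℂ} {r : ℕ}
    (h : HasDetRepr f r) (a : σ → MvPolynomial τ ℂ) (ha : ∀ i, (a i).totalDegree ≤ 1) :
    HasDetRepr (aeval a f) r := by
  obtain ⟨A, hA, rfl⟩ := h
  refine ⟨(aeval a).mapMatrix A, fun i j => ?_, (AlgHom.map_det _ _).symm⟩
  rw [AlgHom.mapMatrix_apply, Matrix.map_apply]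
  exact (HasDetRepr.totalDegree_aeval_le_of_le_one a ha _).trans (hA i j)

end Coeff

/-! ## §3. Prop. 4.4 -/

section Prop44

open MS2001Prop44

/-- **GCT I, Prop. 4.4 — the statement its proof establishes** (AV p.14, all.txt L857–898).
Over `ℂ`: if the padded permanent `perm^φ(Y) = y^{m-n} perm(X)` (`X` the `n × n` block of the
`m × m` variable matrix `Y`, `n ≤ m`) lies in the orbit closure `Δ[det_m(Y)]` — i.e. if the
instance `(n, m)` of Conj. 4.3 fails — then `perm(X)` "can be approximated infinitesimally
closely" by functions `det(W)`, "`W` a matrix [of size `m`] whose each entry is a (possibly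
nonhomogeneous) linear combination of the entries of `X`": for every `ε > 0` there is `q(X)` with
an affine determinantal representation of size `m` all of whose coefficients are within `ε` of
those of `perm(X)`. (The print's final clause, "such a function `det(W)` has a formula of size
`m^{O(log m)}` [2]", is supplied in §4: `formulaComplexity_le_of_hasDetRepr`.) Proof as printed: Zariski =
Euclidean closure of `GL_{m²} · det_m` over `ℂ`, a point `det(σ⁻¹Y)` of the orbit close to
`perm^φ`, then set the foreign variables to `0` and `y` to `1`.
[cite: MulmuleySohoniSIAM2001, Prop. 4.4 (AV p.14, all.txt L857–898)] -/
theorem MS2001_prop_4_4_hasDetRepr {n m : ℕ} [NeZero m] (hnm : n ≤ m)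
    (h : paddedPerPoly ℂ n m ∈ orbitClosure (detPoly (Fin m) ℂ)) {ε : ℝ} (hε : 0 < ε) :
    ∃ q : MvPolynomial (BlockIdx n m × BlockIdx n m) ℂ, HasDetRepr q m ∧
      ∀ e, ‖coeff e q - coeff e (perPoly (BlockIdx n m) ℂ)‖ < ε := by
  classical
  -- degree-`m` coordinates on `V = Sym^m(Y)` and the target coordinates of degree `≤ m` on `X`
  haveI hfin : Fintype {d : Fin m × Fin m →₀ ℕ // d.degree = m} :=
    Fintype.subtype ((Finset.univ : Finset (Fin m × Fin m)).finsuppAntidiag m) fun d => by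
      simp [Finset.mem_finsuppAntidiag, Finsupp.degree_eq_sum]
  haveI hfinE : Fintype {e : BlockIdx n m × BlockIdx n m →₀ ℕ // e.degree ≤ m} :=
    (Finsupp.finite_of_degree_le (σ := BlockIdx n m × BlockIdx n m) m).fintype
  set ρ : MvPolynomial (Fin m × Fin m) ℂ → ({d : Fin m × Fin m →₀ ℕ // d.degree = m} → ℂ) :=
    fun g d => coeffVec g d.1 with hρ
  have hdet : (detPoly (Fin m) ℂ).IsHomogeneous m := by
    simpa only [Fintype.card_fin] using detPoly_isHomogeneous (n := Fin m) (k := ℂ)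
  -- (1) `perm^φ` lies in the Euclidean closure of `GL · det` (Zariski = Euclidean over `ℂ`)
  have hcl : ρ (paddedPerPoly ℂ n m) ∈ closure (ρ '' glOrbit (Fin m × Fin m) ℂ (detPoly (Fin m) ℂ)) := by
    rw [hρ, ← orbitClosure_eq_euclidean_closure_complex_holds hdet]
    exact ⟨_, h, rfl⟩
  -- (2) the substitution, on coefficient vectors, is continuous
  set Λ : ({d : Fin m × Fin m →₀ ℕ // d.degree = m} → ℂ) →
      ({e : BlockIdx n m × BlockIdx n m →₀ ℕ // e.degree ≤ m} → ℂ) :=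
    fun c e => ∑ d, c d * coeff e.1 (aeval (blockSubst n m) (monomial d.1 (1 : ℂ))) with hΛ
  have hΛc : Continuous Λ :=
    continuous_pi fun e => continuous_finsetSum _ fun d _ =>
      (continuous_apply d).mul continuous_const
  have hcl' : Λ (ρ (paddedPerPoly ℂ n m)) ∈
      closure (Λ '' (ρ '' glOrbit (Fin m × Fin m) ℂ (detPoly (Fin m) ℂ))) :=
    image_closure_subset_closure_image hΛc ⟨_, hcl, rfl⟩
  -- (3) an orbit point `det(σ⁻¹ Y)` whose substituted coefficients are `ε`-close
  obtain ⟨_, ⟨_, ⟨g, ⟨A, rfl⟩, rfl⟩, rfl⟩, hdist⟩ := Metric.mem_closure_iff.1 hcl' ε hε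
  have hgh : (linSubstRep (Fin m × Fin m) ℂ A (detPoly (Fin m) ℂ)).IsHomogeneous m := by
    rw [linSubstRep_apply]
    exact linSubst_isHomogeneous _ hdet
  refine ⟨aeval (blockSubst n m) (linSubstRep (Fin m × Fin m) ℂ A (detPoly (Fin m) ℂ)), ?_, ?_⟩
  · -- `det(σ⁻¹Y)` is an interior point: `det` of linear forms; substitute affine forms
    have hint : IsInteriorLimitPoint (detPoly (Fin m) ℂ)
        (linSubstRep (Fin m × Fin m) ℂ A (detPoly (Fin m) ℂ)) :=
      ⟨(A : Matrix (Fin m × Fin m) (Fin m × Fin m) ℂ), rfl⟩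
    exact hasDetRepr_aeval hint.hasDetRepr _ (totalDegree_blockSubst_le n m)
  · intro e
    by_cases he : e.degree ≤ m
    · have h1 := coeff_aeval_eq_sum (n := n) hgh e
      have h2 : coeff e (perPoly (BlockIdx n m) ℂ) = Λ (ρ (paddedPerPoly ℂ n m)) ⟨e, he⟩ := by
        rw [← aeval_blockSubst_paddedPerPoly n m,
          coeff_aeval_eq_sum (n := n) (paddedPerPoly_isHomogeneous hnm) e]
        rfl
      have h3 := (dist_pi_lt_iff hε).1 hdist ⟨e, he⟩
      rw [dist_comm, dist_eq_norm] at h3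
      rw [h1, h2]
      exact h3
    · -- beyond degree `m` both coefficients vanish
      rw [not_le] at he
      have hq : coeff e (aeval (blockSubst n m)
          (linSubstRep (Fin m × Fin m) ℂ A (detPoly (Fin m) ℂ))) = 0 := by
        refine coeff_eq_zero_of_totalDegree_lt ?_
        change _ < e.degree
        exact ((HasDetRepr.totalDegree_aeval_le_of_le_one _ (totalDegree_blockSubst_le n m)
          _).trans hgh.totalDegree_le).trans_lt he
      have hp : coeff e (perPoly (BlockIdx n m) ℂ) = 0 := by
        refine coeff_eq_zero_of_totalDegree_lt ?_
        change _ < e.degree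
        refine ((perPoly_isHomogeneous (n := BlockIdx n m) (k := ℂ)).totalDegree_le.trans
          ?_).trans_lt he
        rw [card_blockIdx hnm]
        exact hnm
      rw [hq, hp, sub_zero, norm_zero]
      exact hε

/-- **GCT I, Prop. 4.4 as printed** (AV p.14, all.txt L857–863): "Suppose `F` is the field of
complex numbers. If Conjecture 4.3 were false then `perm(X)` can be approximated infinitesimally
closely by a formula of quasi-polynomial `n^{O(log n)}` size (in the sense that the coefficients of
the polynomial computed by this formula would be infinitesimally close to those of the
permanent)." With Conj. 4.3 = the tree's `MulmuleySohoniConjecture` (polynomial window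
`n ≤ m ≤ n^c`): if it fails, then for some exponent `c` and infinitely many `n` there is an
`m`, `n ≤ m ≤ n^c`, such that `perm_n` is approximated infinitesimally closely, coefficientwise, by
determinants `det(W)` of `m × m` matrices of affine linear forms — which by [2] (Berkowitz) have
formulas of size `m^{O(log m)} = n^{O(log n)}`: see `MS2001_prop_4_4_formula` (§4) for the version
carrying the explicit formula-size bound.
[cite: MulmuleySohoniSIAM2001, Prop. 4.4 (AV p.14, all.txt L857–898)] -/
theorem MS2001_prop_4_4 (hC : ¬ MulmuleySohoniConjecture) :
    ∃ c : ℕ, ∀ n₀ : ℕ, ∃ n ≥ n₀, ∃ (m : ℕ) (_ : NeZero m), n ≤ m ∧ m ≤ n ^ c ∧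
      ∀ ε : ℝ, 0 < ε → ∃ q : MvPolynomial (BlockIdx n m × BlockIdx n m) ℂ, HasDetRepr q m ∧
        ∀ e, ‖coeff e q - coeff e (perPoly (BlockIdx n m) ℂ)‖ < ε := by
  unfold MulmuleySohoniConjecture at hC
  push Not at hC
  obtain ⟨c, hc⟩ := hC
  refine ⟨c, fun n₀ => ?_⟩
  obtain ⟨n, hn, m, _, hnm, hmc, hmem⟩ := hc n₀
  exact ⟨n, hn, m, inferInstance, hnm, hmc, fun ε hε => MS2001_prop_4_4_hasDetRepr hnm hmem hε⟩

end Prop44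


/-! ## §4. The formula clause: `det(W)` has a formula of quasi-polynomial size ("[2]") -/

section FormulaClause

/-- An affine form in `#σ` variables has a fan-in-two circuit with at most `2 #σ + 2` gates
(the tree's `ArithCircuit.exists_formula_of_totalDegree_le_one`, BCS (21.36) Stage 0).
[cite: BurgisserClausenShokrollahi1997, Thm. (21.36) (proof, Stage 0), p. 567] -/
private theorem MS2001Prop44.complexity_le_of_totalDegree_le_one {σ : Type*} [Fintype σ]
    {p : MvPolynomial σ ℂ} (hp : p.totalDegree ≤ 1) : complexity p ≤ 2 * Fintype.card σ + 2 := by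
  obtain ⟨P, -, -, h2, he, hs⟩ := ArithCircuit.exists_formula_of_totalDegree_le_one hp
  exact (ArithCircuit.complexity_le_size h2 he).trans hs

/-- **A determinant `det(W)` of an `m × m` matrix of affine linear forms in `#σ` variables has a
circuit of size `≤ 8 (m+1)^7 + m² (2 #σ + 2)`**: substitute the `m²` affine entries (each of
circuit size `≤ 2 #σ + 2`) into the tree's polynomial-size circuit for `det_m`
(`complexity_detPoly_le`, Berkowitz; `complexity_aeval_le`). This is the quantitative content of
the print's "[2]" (Berkowitz) at the level of circuits.
[cite: MulmuleySohoniSIAM2001, Prop. 4.4 proof (AV p.14, all.txt L896–898)] -/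
theorem complexity_le_of_hasDetRepr {σ : Type*} [Fintype σ] {q : MvPolynomial σ ℂ} {m : ℕ}
    (h : HasDetRepr q m) :
    complexity q ≤ 8 * (m + 1) ^ 7 + m ^ 2 * (2 * Fintype.card σ + 2) := by
  classical
  obtain ⟨A, hA, rfl⟩ := h
  have hdet : A.det = aeval (fun ij : Fin m × Fin m => A ij.1 ij.2) (detPoly (Fin m) ℂ) := by
    rw [detPoly, AlgHom.map_det, AlgHom.mapMatrix_apply]
    congr 1
    ext i j
    rw [Matrix.map_apply, Matrix.mvPolynomialX_apply, aeval_X]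
  rw [hdet]
  refine (complexity_aeval_le _ _).trans (add_le_add (complexity_detPoly_le ℂ m) ?_)
  calc ∑ ij : Fin m × Fin m, complexity (A ij.1 ij.2)
      ≤ ∑ _ij : Fin m × Fin m, (2 * Fintype.card σ + 2) :=
        Finset.sum_le_sum fun ij _ => MS2001Prop44.complexity_le_of_totalDegree_le_one (hA ij.1 ij.2)
    _ = m ^ 2 * (2 * Fintype.card σ + 2) := by
        rw [Finset.sum_const, Finset.card_univ, Fintype.card_prod, Fintype.card_fin, smul_eq_mul, sq]

/-- **"Such a function `det(W)` has a formula of size `m^{O(log m)}` [2]"** (AV p.14 L896–898),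
quantitatively, from the tree's BCS (21.35)/(21.36) bookkeeping (`formulaComplexity_le_two_pow`):
if `q = det(W)` for an `m × m` matrix `W` of affine linear forms in at most `(m+1)²` variables,
then `q` has a fan-in-two FORMULA of size `≤ 2^{18 (7 log₂(m+1) + 11)²} = m^{O(log m)}`.
[cite: MulmuleySohoniSIAM2001, Prop. 4.4 proof (AV p.14, all.txt L896–898)] -/
theorem formulaComplexity_le_of_hasDetRepr {σ : Type*} [Fintype σ] {q : MvPolynomial σ ℂ}
    {m : ℕ} (h : HasDetRepr q m) (hσ : Fintype.card σ ≤ (m + 1) ^ 2) :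
    formulaComplexity q ≤ 2 ^ (18 * (7 * Nat.log 2 (m + 1) + 11) ^ 2) := by
  have hm1 : m + 1 ≤ 2 ^ (Nat.log 2 (m + 1) + 1) := (Nat.lt_pow_succ_log_self one_lt_two _).le
  have hpow : 16 * (m + 1) ^ 7 ≤ 2 ^ (7 * Nat.log 2 (m + 1) + 11) := by
    calc 16 * (m + 1) ^ 7 ≤ 16 * (2 ^ (Nat.log 2 (m + 1) + 1)) ^ 7 := by gcongr
      _ = 2 ^ (7 * Nat.log 2 (m + 1) + 11) := by
        rw [← pow_mul, show (16 : ℕ) = 2 ^ 4 by norm_num, ← pow_add]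
        ring_nf
  have h7 : (m + 1) ^ 2 ≤ (m + 1) ^ 7 := Nat.pow_le_pow_right (Nat.succ_pos m) (by norm_num)
  have h47 : (m + 1) ^ 4 ≤ (m + 1) ^ 7 := Nat.pow_le_pow_right (Nat.succ_pos m) (by norm_num)
  have hsq : 1 ≤ (m + 1) ^ 2 := Nat.one_le_pow _ _ (Nat.succ_pos m)
  have hlin : m ^ 2 * (2 * Fintype.card σ + 2) ≤ 8 * (m + 1) ^ 7 := by
    calc m ^ 2 * (2 * Fintype.card σ + 2) ≤ (m + 1) ^ 2 * (4 * (m + 1) ^ 2) :=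
          Nat.mul_le_mul (Nat.pow_le_pow_left (Nat.le_succ m) 2) (by omega)
      _ = 4 * (m + 1) ^ 4 := by ring
      _ ≤ 8 * (m + 1) ^ 7 := Nat.mul_le_mul (by norm_num) h47
  have hL : complexity q ≤ 2 ^ (7 * Nat.log 2 (m + 1) + 11) := by
    have := complexity_le_of_hasDetRepr h
    omega
  have hlt : m < 2 ^ (7 * Nat.log 2 (m + 1) + 11) := by
    have : m + 1 ≤ (m + 1) ^ 7 := by
      calc m + 1 = (m + 1) ^ 1 := (pow_one _).symm
        _ ≤ (m + 1) ^ 7 := Nat.pow_le_pow_right (Nat.succ_pos m) (by norm_num)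
    omega
  have hn : Fintype.card σ ≤ 2 ^ (7 * Nat.log 2 (m + 1) + 11) := by omega
  exact formulaComplexity_le_two_pow (totalDegree_le_of_hasDetRepr_holds h) hlt hn hL (by omega)

/-- `log₂` bookkeeping for the window `m ≤ n^c`: `log₂(m+1) ≤ c (log₂ n + 1) + 1`. [folklore] -/
private theorem MS2001Prop44.log_succ_le_of_le_pow {n m c : ℕ} (hmc : m ≤ n ^ c) :
    Nat.log 2 (m + 1) ≤ c * (Nat.log 2 n + 1) + 1 := by
  have h1 : n ≤ 2 ^ (Nat.log 2 n + 1) := (Nat.lt_pow_succ_log_self one_lt_two n).le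
  have h2 : n ^ c ≤ 2 ^ (c * (Nat.log 2 n + 1)) := by
    rw [mul_comm, pow_mul]
    exact Nat.pow_le_pow_left h1 c
  have h3 : m + 1 < 2 ^ (c * (Nat.log 2 n + 1) + 2) := by
    have h4 : 1 ≤ 2 ^ (c * (Nat.log 2 n + 1)) := Nat.one_le_two_pow
    calc m + 1 ≤ 2 ^ (c * (Nat.log 2 n + 1)) + 2 ^ (c * (Nat.log 2 n + 1)) := by omega
      _ = 2 ^ (c * (Nat.log 2 n + 1) + 1) := by rw [pow_succ]; ring
      _ < 2 ^ (c * (Nat.log 2 n + 1) + 2) := Nat.pow_lt_pow_right (by norm_num) (by omega)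
  have := Nat.log_lt_of_lt_pow (by omega : m + 1 ≠ 0) h3
  omega

/-- **GCT I, Prop. 4.4 as printed, with the formula-size clause** (AV p.14, all.txt L857–898):
if Conj. 4.3 (the tree's `MulmuleySohoniConjecture`) fails, then for some exponent `c`, a
constant `c'`, and infinitely many `n`, there is an `m` with `n ≤ m ≤ n^c` such that for every
`ε > 0` some polynomial `q(X)` with an affine determinantal representation `det(W)` of size `m` AND A
FAN-IN-TWO FORMULA OF QUASI-POLYNOMIAL SIZE `≤ 2^{c' (log₂ n + 1)²} = n^{O(log n)}` has all its
coefficients within `ε` of those of `perm(X)` ("`perm(X)` can be approximated infinitesimally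
closely by a formula of quasi-polynomial `n^{O(log n)}` size"). The formula bound is the print's
"[2]" (Berkowitz), here the tree's `complexity_detPoly_le` + BCS (21.35)/(21.36)
(`formulaComplexity_le_two_pow`). [cite: MulmuleySohoniSIAM2001, Prop. 4.4 (AV p.14, all.txt L857–898)] -/
theorem MS2001_prop_4_4_formula (hC : ¬ MulmuleySohoniConjecture) :
    ∃ c c' : ℕ, ∀ n₀ : ℕ, ∃ n ≥ n₀, ∃ (m : ℕ) (_ : NeZero m), n ≤ m ∧ m ≤ n ^ c ∧
      ∀ ε : ℝ, 0 < ε → ∃ q : MvPolynomial (BlockIdx n m × BlockIdx n m) ℂ, HasDetRepr q m ∧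
        formulaComplexity q ≤ 2 ^ (c' * (Nat.log 2 n + 1) ^ 2) ∧
        ∀ e, ‖coeff e q - coeff e (perPoly (BlockIdx n m) ℂ)‖ < ε := by
  obtain ⟨c, hc⟩ := MS2001_prop_4_4 hC
  refine ⟨c, 18 * (7 * c + 18) ^ 2, fun n₀ => ?_⟩
  obtain ⟨n, hn, m, hm, hnm, hmc, happ⟩ := hc n₀
  refine ⟨n, hn, m, hm, hnm, hmc, fun ε hε => ?_⟩
  obtain ⟨q, hq, hclose⟩ := happ ε hε
  refine ⟨q, hq, ?_, hclose⟩
  have hσ : Fintype.card (BlockIdx n m × BlockIdx n m) ≤ (m + 1) ^ 2 := by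
    rw [Fintype.card_prod, card_blockIdx hnm, sq]
    exact Nat.mul_le_mul (by omega) (by omega)
  refine (formulaComplexity_le_of_hasDetRepr hq hσ).trans (Nat.pow_le_pow_right (by norm_num) ?_)
  have hlog := MS2001Prop44.log_succ_le_of_le_pow hmc
  have hK : 7 * Nat.log 2 (m + 1) + 11 ≤ (7 * c + 18) * (Nat.log 2 n + 1) := by
    have h1 : 7 * Nat.log 2 (m + 1) ≤ 7 * c * (Nat.log 2 n + 1) + 7 := by
      calc 7 * Nat.log 2 (m + 1) ≤ 7 * (c * (Nat.log 2 n + 1) + 1) := Nat.mul_le_mul_left _ hlog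
        _ = 7 * c * (Nat.log 2 n + 1) + 7 := by ring
    have h2 : 18 ≤ 18 * (Nat.log 2 n + 1) := Nat.le_mul_of_pos_right _ (Nat.succ_pos _)
    calc 7 * Nat.log 2 (m + 1) + 11 ≤ 7 * c * (Nat.log 2 n + 1) + 18 := by omega
      _ ≤ 7 * c * (Nat.log 2 n + 1) + 18 * (Nat.log 2 n + 1) := by omega
      _ = (7 * c + 18) * (Nat.log 2 n + 1) := by ring
  calc 18 * (7 * Nat.log 2 (m + 1) + 11) ^ 2 ≤ 18 * ((7 * c + 18) * (Nat.log 2 n + 1)) ^ 2 :=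
        Nat.mul_le_mul_left _ (Nat.pow_le_pow_left hK 2)
    _ = 18 * (7 * c + 18) ^ 2 * (Nat.log 2 n + 1) ^ 2 := by ring

end FormulaClause


/-! ## §5. Every point of `Δ[det_m]` is approximated by quasi-polynomial-size formulas (§4.2) -/

section EveryPoint

/-- **"Though `h(Y)` is an exterior limit point, it can be approximated infinitesimally closely
by a formula of quasi-polynomial size (Proposition 4.4)"** (AV p.18, all.txt L1296–1298):
over `ℂ`, EVERY point `f` of the orbit closure `Δ[det_m]` — interior or exterior — is, for every
`ε > 0`, coefficientwise `ε`-close to a point `det(σ⁻¹Y)` of the orbit `GL_{m²} · det_m`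
itself, which has an affine (indeed linear) determinantal representation of size `m`
(`IsInteriorLimitPoint.hasDetRepr`) and hence (§4) a fan-in-two formula of size
`≤ 2^{18(7 log₂(m+1)+11)²} = m^{O(log m)}`. (Zariski = Euclidean closure over `ℂ`,
`orbitClosure_eq_euclidean_closure_complex_holds`.)
[cite: MulmuleySohoniSIAM2001, §4.2 (AV p.18, all.txt L1296–1298)] -/
theorem MS2001_sec_4_2_approx_of_mem_orbitClosure_detPoly {m : ℕ}
    {f : MvPolynomial (Fin m × Fin m) ℂ} (h : f ∈ orbitClosure (detPoly (Fin m) ℂ))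
    {ε : ℝ} (hε : 0 < ε) :
    ∃ q : MvPolynomial (Fin m × Fin m) ℂ, q ∈ glOrbit (Fin m × Fin m) ℂ (detPoly (Fin m) ℂ) ∧
      HasDetRepr q m ∧ formulaComplexity q ≤ 2 ^ (18 * (7 * Nat.log 2 (m + 1) + 11) ^ 2) ∧
      ∀ e, ‖coeff e q - coeff e f‖ < ε := by
  classical
  haveI hfin : Fintype {d : Fin m × Fin m →₀ ℕ // d.degree = m} :=
    Fintype.subtype ((Finset.univ : Finset (Fin m × Fin m)).finsuppAntidiag m) fun d => by
      simp [Finset.mem_finsuppAntidiag, Finsupp.degree_eq_sum]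
  set ρ : MvPolynomial (Fin m × Fin m) ℂ → ({d : Fin m × Fin m →₀ ℕ // d.degree = m} → ℂ) :=
    fun g d => coeffVec g d.1 with hρ
  have hdet : (detPoly (Fin m) ℂ).IsHomogeneous m := by
    simpa only [Fintype.card_fin] using detPoly_isHomogeneous (n := Fin m) (k := ℂ)
  have hfh : f.IsHomogeneous m := ((mem_orbitClosure_iff_homogeneous_holds hdet).1 h).1
  have hcl : ρ f ∈ closure (ρ '' glOrbit (Fin m × Fin m) ℂ (detPoly (Fin m) ℂ)) := by
    rw [hρ, ← orbitClosure_eq_euclidean_closure_complex_holds hdet]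
    exact ⟨_, h, rfl⟩
  obtain ⟨_, ⟨_, ⟨A, rfl⟩, rfl⟩, hdist⟩ := Metric.mem_closure_iff.1 hcl ε hε
  have hqh : (linSubstRep (Fin m × Fin m) ℂ A (detPoly (Fin m) ℂ)).IsHomogeneous m := by
    rw [linSubstRep_apply]
    exact linSubst_isHomogeneous _ hdet
  have hint : IsInteriorLimitPoint (detPoly (Fin m) ℂ)
      (linSubstRep (Fin m × Fin m) ℂ A (detPoly (Fin m) ℂ)) :=
    ⟨(A : Matrix (Fin m × Fin m) (Fin m × Fin m) ℂ), rfl⟩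
  have hσ : Fintype.card (Fin m × Fin m) ≤ (m + 1) ^ 2 := by
    rw [Fintype.card_prod, Fintype.card_fin, sq]
    exact Nat.mul_le_mul (Nat.le_succ m) (Nat.le_succ m)
  refine ⟨_, ⟨A, rfl⟩, hint.hasDetRepr, formulaComplexity_le_of_hasDetRepr hint.hasDetRepr hσ,
    fun e => ?_⟩
  by_cases he : e.degree = m
  · have h3 := (dist_pi_lt_iff hε).1 hdist ⟨e, he⟩
    rw [dist_comm, dist_eq_norm] at h3
    exact h3
  · rw [hqh.coeff_eq_zero he, hfh.coeff_eq_zero he, sub_zero, norm_zero]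
    exact hε

end EveryPoint

end Literature.Computability.AlgebraicComplexity
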